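import Literature.MathematicalPhysics.KineticTheory.InfiniteChainCurrentPositiveType
import HarnessLib

/-!
# `stub_witnessPositiveType` of line `loomis-compact-horizon-witness`
(crux `EmbeddedDrudeMourre.AbelThermodynamicLimit`, item stmt-AtomisticToContinuum-12596;
`--supports` file proving the registered stub S2 verbatim, closes nothing)

The registered stub: for `P = pinnedChain ω₂ lam β γ` (all `> 0`), `T > 0`, a DLR state `μT` at `T`
that is shift-invariant and satisfies Buttà–Marchioro's superstability estimate, and a
`μT`-preserving dynamics `D` with `D.carrier ⊆ bmGood P` and absolutely convergent summed current
correlations at every time, the current autocorrelation `C_T = D.currentCorrelation μT` is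
measurable, bounded, and its doubly integrated form `V(t) = ∫₀ᵗ (t-u) C_T(u) du` is non-negative
for `t ≥ 0` — the Tauberian condition consumed by `stub_karamataRieszTwo`.

Proof: the pinned chain is in the Buttà–Marchioro class (`U`, `V` even non-negative polynomials of
degree `4`), so this is the instance `s₁ = s₂ = 2` of
`Literature.MathematicalPhysics.KineticTheory.HeatConduction.InfiniteChainDynamics.currentCorrelation_positiveType_of_carrier_subset_bmGood`
(Koopman isometries of the `μT`-preserving flow, which is the BM flow on the carrier and therefore
commutes with the lattice translations a.e.; shift covariance of the pair correlations; Fejér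
averaging `n⁻¹ ∫ J_n (J_n ∘ φ_t) → C_T(t)` against absolute convergence; positivity of
`∫₀ᵗ (t-u) ∫ J_n (J_n ∘ φ_u) du = ½ ∫ (∫₀ᵗ J_n ∘ φ_u du)² dμT` by Fubini; dominated convergence).
The bound is `M = C_T(0)`. The Gibbs property, `T` and `γ > 0` are not used.
-/

noncomputable section

open MeasureTheory Set

namespace Summit.AtomisticToContinuum.FouriersLaw.Theorems.AbelThermodynamicLimit.LoomisCompactHorizonWitness

open Literature.MathematicalPhysics.KineticTheory.HeatConduction

/-- **S2 `stub_witnessPositiveType` — positive type of the REGULAR witness's current autocorrelation.**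
For `P = pinnedChain ω₂ lam β γ` (all `> 0`), `T > 0`, a DLR state `μT` at `T` that is shift-invariant
and BM-superstable, and a `μT`-preserving dynamics `D` with `D.carrier ⊆ bmGood P` and absolutely
convergent summed current correlations at every time: `C_T = D.currentCorrelation μT` is measurable,
bounded (by `C_T(0)`), and `∫₀ᵗ (t-u) C_T(u) du ≥ 0` for `t ≥ 0` (instance `s₁ = s₂ = 2` of
`InfiniteChainDynamics.currentCorrelation_positiveType_of_carrier_subset_bmGood`). -/
theorem stub_witnessPositiveType :
    ∀ ω₂ lam β γ : ℝ, 0 < ω₂ → 0 < lam → 0 < β → 0 < γ → ∀ T : ℝ, 0 < T →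
      ∀ (μT : MeasureTheory.Measure
            Literature.MathematicalPhysics.KineticTheory.HeatConduction.ChainConfig)
        (D : Literature.MathematicalPhysics.KineticTheory.HeatConduction.InfiniteChainDynamics
          (Literature.MathematicalPhysics.KineticTheory.HeatConduction.pinnedChain ω₂ lam β γ)),
        (Literature.MathematicalPhysics.KineticTheory.HeatConduction.pinnedChain
            ω₂ lam β γ).IsChainGibbsMeasure T μT →
        Literature.MathematicalPhysics.KineticTheory.HeatConduction.IsShiftInvariant μT →
        (Literature.MathematicalPhysics.KineticTheory.HeatConduction.pinnedChain
            ω₂ lam β γ).HasSuperstabilityEstimate μT →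
        D.carrier ⊆ (Literature.MathematicalPhysics.KineticTheory.HeatConduction.pinnedChain
            ω₂ lam β γ).bmGood →
        D.PreservesMeasure μT →
        (∀ t : ℝ, D.HasAbsConvergentCorrelation μT t) →
        Measurable (D.currentCorrelation μT) ∧
        (∃ M : ℝ, ∀ t : ℝ, |D.currentCorrelation μT t| ≤ M) ∧
        ∀ t : ℝ, 0 ≤ t →
          0 ≤ ∫ u in Set.Ioc (0 : ℝ) t, (t - u) * D.currentCorrelation μT u := by
  intro ω₂ lam β γ hω hl hβ _hγ T _hT μT D _hG hS hss hcar hP hAC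
  obtain ⟨hmeas, hbd, hpos⟩ := D.currentCorrelation_positiveType_of_carrier_subset_bmGood
    (s₁ := 2) (s₂ := 2) (by norm_num) (by norm_num)
    (OscillatorChain.pinnedChain_isEvenPolyOfDegree_U β γ hω.le hl)
    (OscillatorChain.pinnedChain_isEvenPolyOfDegree_V ω₂ lam γ hβ) hss hS hcar hP hAC
  exact ⟨hmeas, ⟨D.currentCorrelation μT 0, hbd⟩, hpos⟩

end Summit.AtomisticToContinuum.FouriersLaw.Theorems.AbelThermodynamicLimit.LoomisCompactHorizonWitness

end
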